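import Summits.RiemannHypothesis.RiemannHypothesis.Theorems.WeilFormatCPolyWindowConstants
import HarnessLib

/-!
# Format C, design C∞ (L2–IX′): the node integrals of the window constants as a POSITIVE series (well-conditioned form)

Route context: Fourier–Galerkin / Schur-complement certificates of Weil positivity on a window ("format C";
cell memo `run/shared/lean/pub/rh-explicit/rh-explicit-weil-10/KERNEL-LEVER.md` §18 (numerical note); supporting
stmt-RiemannHypothesis-0098; seat rh-explicit-weil-10).  The node terms `T = ∫_{(0,T]} e^{−lt} t^p dt` of the window constants
`W_p(a) = Σ_k ∫_{(0,2a]} e^{−l_k t}t^p` (`WeilFormatCPolyWindowArch/Constants`) have the closed form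
`p!/l^{p+1} − e^{−lT}Σ_{m≤p} p^{(m)}T^{p−m}/l^{m+1}` — a difference of two nearly equal numbers when `lT ≪ p` (at `a = 1`,
`p = 33`, node `l_0 = ½`: 39 decimal digits cancel).  For the (E) enclosures this file rewrites the node term as the
POSITIVE incomplete-Gamma tail series

  `∫_{(0,T]} e^{−lt} t^p dt = (p!/l^{p+1}) · e^{−lT} · Σ_{i≥0} (lT)^{i+p+1}/(i+p+1)!`   (`l > 0`, `T ≥ 0`),

which is summed without cancellation (`setIntegral_exp_neg_mul_pow_eq_tsum`; the finite reindexing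
`Σ_{m≤p} p^{(m)}T^{p−m}/l^{m+1} = (p!/l^{p+1})Σ_{i≤p}(lT)^i/i!` is `sum_descFactorial_mul_pow_div_eq`).

Pure bookkeeping; standard axioms; no RH claim.
-/

set_option autoImplicit false
-- `Summit.RiemannHypothesis.RiemannHypothesis.…` is the layout-mandated namespace (summit = problem name).
set_option linter.dupNamespace false

noncomputable section

open Complex Filter Set MeasureTheory
open scoped Real Topology Nat

namespace Summit.RiemannHypothesis.RiemannHypothesis.Theorems.WeilFormatC

open Literature.NumberTheory.LFunctions

/-- Reindexing the correction sum: `Σ_{m≤p} p^{(m)} T^{p−m}/l^{m+1} = (p!/l^{p+1}) Σ_{i≤p} (lT)^i/i!` (`l ≠ 0`). -/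
theorem sum_descFactorial_mul_pow_div_eq {l : ℝ} (hl : l ≠ 0) (T : ℝ) (p : ℕ) :
    ∑ m ∈ Finset.range (p + 1), (p.descFactorial m : ℝ) * T ^ (p - m) / l ^ (m + 1) =
      (p.factorial : ℝ) / l ^ (p + 1) * ∑ i ∈ Finset.range (p + 1), (l * T) ^ i / (i.factorial : ℝ) := by
  rw [Finset.mul_sum, ← Finset.sum_range_reflect _ (p + 1)]
  refine Finset.sum_congr rfl fun i hi ↦ ?_
  have hip : i ≤ p := Nat.lt_succ_iff.1 (Finset.mem_range.1 hi)
  have e1 : p + 1 - 1 - i = p - i := by omega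
  rw [e1]
  -- `p^{(p-i)} = p!/i!`
  have hdf : (p.descFactorial (p - i) : ℝ) * (i.factorial : ℝ) = (p.factorial : ℝ) := by
    have h := Nat.factorial_mul_descFactorial (Nat.sub_le p i)
    rw [show p - (p - i) = i by omega] at h
    exact_mod_cast (by rw [mul_comm]; exact h)
  have hi0 : (i.factorial : ℝ) ≠ 0 := by exact_mod_cast (Nat.factorial_pos i).ne'
  have hdf' : (p.descFactorial (p - i) : ℝ) = (p.factorial : ℝ) / (i.factorial : ℝ) := by
    rw [eq_div_iff hi0, hdf]
  rw [hdf', show p - (p - i) = i by omega]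
  -- `T^i/l^{p-i+1} = (lT)^i / l^{p+1}`
  have hl1 : l ^ (p + 1) = l ^ (p - i + 1) * l ^ i := by
    rw [← pow_add]; congr 1; omega
  rw [mul_pow, hl1]
  field_simp

/-- The exponential tail series: `Σ_{i≥0} x^{i+p+1}/(i+p+1)! = e^x − Σ_{i≤p} x^i/i!`. -/
theorem hasSum_pow_div_factorial_tail (x : ℝ) (p : ℕ) :
    HasSum (fun i : ℕ ↦ x ^ (i + (p + 1)) / ((i + (p + 1)).factorial : ℝ))
      (Real.exp x - ∑ i ∈ Finset.range (p + 1), x ^ i / (i.factorial : ℝ)) := by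
  have hexp : HasSum (fun n : ℕ ↦ x ^ n / (n.factorial : ℝ)) (Real.exp x) := by
    rw [Real.exp_eq_exp_ℝ]
    exact NormedSpace.expSeries_div_hasSum_exp x
  have h := (hasSum_nat_add_iff' (p + 1)).2 hexp
  exact h

/-- **The node integral as a positive series** (`l > 0`, `T ≥ 0`):
`∫_{(0,T]} e^{−lt} t^p dt = (p!/l^{p+1}) e^{−lT} Σ_{i≥0} (lT)^{i+p+1}/(i+p+1)!` — every term non-negative, no cancellation. -/
theorem setIntegral_exp_neg_mul_pow_eq_tsum {l T : ℝ} (hl : 0 < l) (hT : 0 ≤ T) (p : ℕ) :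
    ∫ t in Ioc 0 T, Real.exp (-(l * t)) * t ^ p =
      (p.factorial : ℝ) / l ^ (p + 1) * Real.exp (-(l * T)) *
        ∑' i : ℕ, (l * T) ^ (i + (p + 1)) / ((i + (p + 1)).factorial : ℝ) := by
  rw [setIntegral_exp_neg_mul_pow_eq hl.ne' hT, sum_descFactorial_mul_pow_div_eq hl.ne' T p,
    (hasSum_pow_div_factorial_tail (l * T) p).tsum_eq]
  have hee : Real.exp (-(l * T)) * Real.exp (l * T) = 1 := by rw [← Real.exp_add]; simp
  linear_combination (-(p.factorial : ℝ) / l ^ (p + 1)) * hee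

/-- The terms of the node series are non-negative (`l, T ≥ 0`). -/
theorem pow_div_factorial_tail_nonneg {l T : ℝ} (hl : 0 ≤ l) (hT : 0 ≤ T) (p i : ℕ) :
    0 ≤ (l * T) ^ (i + (p + 1)) / ((i + (p + 1)).factorial : ℝ) := by
  positivity

end Summit.RiemannHypothesis.RiemannHypothesis.Theorems.WeilFormatC

end
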